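import Summits.Ventures.PercRepro.HyperplaneKeyGeneral

/-!
# PercRepro — THE HYPERPLANE KEY, UNIFORM IN `(p, q)`: EVERY ROW OF EVERY LEVEL HAS AN EXPLICIT FINITE WINDOW (p1, gen 42; S2 / S3 / S4 feeder)

`rls_of_hyperplane_key` with the universal `e`-free cap `#{ρ ≤ q} ≤ Σ_{j ≤ q} C(n, j)·2^{2^j − 1 − j} ≤ (q + 1)·n^q·2^{2^q}`,
`Φ(p, q) ≤ 2^{p+q}` and the elementary `n^q ≤ 2^{⌊n/4⌋}` for `n ≥ 32q²` (`(n+4)^q ≤ 2·n^q` from `n ≥ 8q`, base window by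
`q² ≤ 4^q`): **`ThmN.RLS M p q` for every `e`-free `M` of rank `p` on `n ≥ max (32q²) (4(p + 2q + 2^q + 1))` points**
(`rls_of_hyperplane_key_uniform`). So at EVERY level `q` and EVERY row `p` the `e`-free core cells `(p, d)` with
`d ≥ N(p, q) − p` are theorems — the open cells of every row form an explicit finite window (the per-row numerals of
HyperplaneKeyFive / HyperplaneKeySix are much sharper: `82 … 92` at level 5, `136 … 152` at level 6, against `N = 800`, `1152`
here). Nothing about any cell below `N(p, q)` is claimed.

* `pow_add_four_mul_le`, `pow_add_four_le_two_mul`, `sq_le_four_pow`, `pow_le_two_pow_div_four` — the arithmetic;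
* `phiK_le_two_pow` — `Φ(p, q) ≤ 2^{p+q}`;
* `sum_choose_two_pow_le` — the cap bound `(q + 1)·n^q·2^{2^q}`;
* **`rls_of_hyperplane_key_uniform`**.
Axioms: standard.
-/

open scoped Matroid

namespace PercRepro

namespace HypKey

open Set

variable {α : Type}

/-- `(n + 4)^q · (n − 4q) ≤ n^{q+1}` for `4q ≤ n`. -/
theorem pow_add_four_mul_le (n q : ℕ) (h : 4 * q ≤ n) : (n + 4) ^ q * (n - 4 * q) ≤ n ^ (q + 1) := by
  induction q with
  | zero => simp
  | succ q ih =>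
    have h' : 4 * q ≤ n := by omega
    have ih' := ih h'
    have hq : 4 * q + 4 ≤ n := by omega
    have e : (n + 4) ^ (q + 1) * (n - 4 * (q + 1)) = (n + 4) ^ q * ((n - 4 * (q + 1)) * (n + 4)) := by ring
    rw [e]
    have h2 : (n - 4 * (q + 1)) * (n + 4) ≤ (n - 4 * q) * n := by
      have hq' : 4 * (q + 1) ≤ n := h
      zify [hq', h']
      nlinarith
    calc (n + 4) ^ q * ((n - 4 * (q + 1)) * (n + 4)) ≤ (n + 4) ^ q * ((n - 4 * q) * n) :=
          Nat.mul_le_mul_left _ h2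
      _ = (n + 4) ^ q * (n - 4 * q) * n := by ring
      _ ≤ n ^ (q + 1) * n := Nat.mul_le_mul_right _ ih'
      _ = n ^ (q + 1 + 1) := by ring

/-- `(n + 4)^q ≤ 2·n^q` for `8q ≤ n`. -/
theorem pow_add_four_le_two_mul (n q : ℕ) (h : 8 * q ≤ n) : (n + 4) ^ q ≤ 2 * n ^ q := by
  have h1 := pow_add_four_mul_le n q (by omega)
  have h2 : n ≤ 2 * (n - 4 * q) := by omega
  rcases Nat.eq_zero_or_pos n with hn | hn
  · subst hn
    rcases q with _ | q
    · simp
    · omega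
  have h3 : (n + 4) ^ q * n ≤ 2 * n ^ (q + 1) := by
    calc (n + 4) ^ q * n ≤ (n + 4) ^ q * (2 * (n - 4 * q)) := Nat.mul_le_mul_left _ h2
      _ = 2 * ((n + 4) ^ q * (n - 4 * q)) := by ring
      _ ≤ 2 * n ^ (q + 1) := Nat.mul_le_mul_left _ h1
  have h4 : (n + 4) ^ q * n ≤ (2 * n ^ q) * n := by
    calc (n + 4) ^ q * n ≤ 2 * n ^ (q + 1) := h3
      _ = (2 * n ^ q) * n := by ring
  exact Nat.le_of_mul_le_mul_right h4 hn

/-- `q² ≤ 4^q`. -/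
theorem sq_le_four_pow (q : ℕ) : q ^ 2 ≤ 4 ^ q := by
  induction q with
  | zero => simp
  | succ q ih =>
    have h4 : 4 ^ (q + 1) = 4 * 4 ^ q := by ring
    have hq : q < 2 ^ q := Nat.lt_two_pow_self
    have h24 : 2 ^ q ≤ 4 ^ q := Nat.pow_le_pow_left (by norm_num) q
    rw [h4]
    nlinarith [ih, hq, h24]

/-- `n^q ≤ 2^{⌊n/4⌋}` for `32q² ≤ n`. -/
theorem pow_le_two_pow_div_four (q : ℕ) : ∀ n, 32 * q ^ 2 ≤ n → n ^ q ≤ 2 ^ (n / 4) := by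
  rcases Nat.eq_zero_or_pos q with hq0 | hq1
  · subst hq0; intro n _; simp only [pow_zero]; exact Nat.one_le_two_pow
  have base : ∀ n, 32 * q ^ 2 ≤ n → n ≤ 32 * q ^ 2 + 3 → n ^ q ≤ 2 ^ (n / 4) := by
    intro n hn hn'
    have hdiv : 8 * q ^ 2 ≤ n / 4 := by omega
    have hq2 : 3 ≤ 3 * q ^ 2 := by nlinarith
    calc n ^ q ≤ (35 * q ^ 2) ^ q := Nat.pow_le_pow_left (by omega) q
      _ ≤ (256 ^ q) ^ q := by
          apply Nat.pow_le_pow_left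
          calc 35 * q ^ 2 ≤ 35 * 4 ^ q := Nat.mul_le_mul_left _ (sq_le_four_pow q)
            _ ≤ 64 ^ q * 4 ^ q := by
                have : 35 ≤ 64 ^ q := by
                  calc 35 ≤ 64 := by norm_num
                    _ = 64 ^ 1 := by norm_num
                    _ ≤ 64 ^ q := Nat.pow_le_pow_right (by norm_num) hq1
                exact Nat.mul_le_mul_right _ this
            _ = 256 ^ q := by rw [← Nat.mul_pow]
      _ = 2 ^ (8 * q ^ 2) := by
          rw [← pow_mul, show (256 : ℕ) = 2 ^ 8 by norm_num, ← pow_mul]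
          ring_nf
      _ ≤ 2 ^ (n / 4) := Nat.pow_le_pow_right (by norm_num) hdiv
  have step : ∀ n, 32 * q ^ 2 ≤ n → n ^ q ≤ 2 ^ (n / 4) → (n + 4) ^ q ≤ 2 ^ ((n + 4) / 4) := by
    intro n hn ih
    have h8 : 8 * q ≤ n := by nlinarith
    rw [Nat.add_div_right n (by norm_num : 0 < 4), pow_succ]
    calc (n + 4) ^ q ≤ 2 * n ^ q := pow_add_four_le_two_mul n q h8
      _ ≤ 2 * 2 ^ (n / 4) := Nat.mul_le_mul_left _ ih
      _ = 2 ^ (n / 4) * 2 := by ring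
  have key : ∀ m n, 32 * q ^ 2 ≤ n → n ≤ 32 * q ^ 2 + 3 + 4 * m → n ^ q ≤ 2 ^ (n / 4) := by
    intro m
    induction m with
    | zero => intro n hn hn'; exact base n hn (by omega)
    | succ m ih =>
      intro n hn hn'
      by_cases hsmall : n ≤ 32 * q ^ 2 + 3 + 4 * m
      · exact ih n hn hsmall
      · obtain ⟨n', rfl⟩ : ∃ n', n = n' + 4 := ⟨n - 4, by omega⟩
        exact step n' (by omega) (ih n' (by omega) (by omega))
  intro n hn
  exact key n n hn (by omega)


/-- `Φ(p, q) ≤ 2^{p+q}`: the numerator is part of the binomial sum `2^{p+q}` and the denominator is `≥ 1`. -/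
theorem phiK_le_two_pow (p q : ℕ) : phiK p q ≤ (2 : ℚ) ^ (p + q) := by
  unfold phiK
  have hden : (1 : ℚ) ≤ ((p + q).choose p : ℚ) := by
    exact_mod_cast Nat.succ_le_of_lt (Nat.choose_pos (by omega))
  have hnum : (∑ u ∈ Finset.Ioo q p, ((p + q).choose u : ℚ)) ≤ (2 : ℚ) ^ (p + q) := by
    calc (∑ u ∈ Finset.Ioo q p, ((p + q).choose u : ℚ))
        ≤ ∑ u ∈ Finset.range (p + q + 1), ((p + q).choose u : ℚ) := by
          refine Finset.sum_le_sum_of_subset_of_nonneg ?_ (fun _ _ _ => Nat.cast_nonneg _)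
          intro u hu
          have := Finset.mem_Ioo.1 hu
          exact Finset.mem_range.2 (by omega)
      _ = (2 : ℚ) ^ (p + q) := by exact_mod_cast Nat.sum_range_choose (p + q)
  calc (∑ u ∈ Finset.Ioo q p, ((p + q).choose u : ℚ)) / ((p + q).choose p : ℚ)
      ≤ ∑ u ∈ Finset.Ioo q p, ((p + q).choose u : ℚ) :=
        div_le_self (Finset.sum_nonneg (fun _ _ => Nat.cast_nonneg _)) hden
    _ ≤ (2 : ℚ) ^ (p + q) := hnum

/-- The universal cap is at most `(q + 1)·n^q·2^{2^q}` for `n ≥ 1`. -/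
theorem sum_choose_two_pow_le (n q : ℕ) (hn : 1 ≤ n) :
    (∑ j ∈ Finset.range (q + 1), (n.choose j : ℚ) * 2 ^ (2 ^ j - 1 - j)) ≤
      (q + 1 : ℚ) * (n : ℚ) ^ q * 2 ^ (2 ^ q) := by
  have hterm : ∀ j ∈ Finset.range (q + 1), (n.choose j : ℚ) * 2 ^ (2 ^ j - 1 - j) ≤
      (n : ℚ) ^ q * 2 ^ (2 ^ q) := by
    intro j hj
    have hjq : j ≤ q := Nat.lt_succ_iff.1 (Finset.mem_range.1 hj)
    have h1 : (n.choose j : ℚ) ≤ (n : ℚ) ^ q := by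
      have : n.choose j ≤ n ^ q := (Nat.choose_le_pow n j).trans (Nat.pow_le_pow_right hn hjq)
      exact_mod_cast this
    have h2 : (2 : ℚ) ^ (2 ^ j - 1 - j) ≤ 2 ^ (2 ^ q) := by
      apply pow_le_pow_right₀ (by norm_num)
      have := Nat.pow_le_pow_right (show 1 ≤ 2 by norm_num) hjq
      exact (Nat.sub_le _ _).trans ((Nat.sub_le _ _).trans this)
    exact mul_le_mul h1 h2 (by positivity) (by positivity)
  calc (∑ j ∈ Finset.range (q + 1), (n.choose j : ℚ) * 2 ^ (2 ^ j - 1 - j))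
      ≤ (Finset.range (q + 1)).card • ((n : ℚ) ^ q * 2 ^ (2 ^ q)) :=
        Finset.sum_le_card_nsmul _ _ _ hterm
    _ = (q + 1 : ℚ) * (n : ℚ) ^ q * 2 ^ (2 ^ q) := by
        rw [Finset.card_range, nsmul_eq_mul]
        push_cast
        ring

/-- **THE HYPERPLANE KEY, UNIFORM IN `(p, q)`.** `e`-free, `ρ(E) = p`, and `n ≥ max (32q²) (4(p + 2q + 2^q + 1))` give
`ThmN.RLS M p q`. -/
theorem rls_of_hyperplane_key_uniform (M : Matroid α) [M.Finite] (p q : ℕ) (hR : M.eRank = (p : ℕ∞))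
    (hfree : ∀ e ∈ M.E, ∃ A ⊆ M.E \ {e}, e ∉ M.closure A ∧ e ∉ M.closure ((M.E \ {e}) \ A))
    (hn : max (32 * q ^ 2) (4 * (p + 2 * q + 2 ^ q + 1)) ≤ M.E.ncard) : ThmN.RLS M p q := by
  have hn1 : 32 * q ^ 2 ≤ M.E.ncard := le_trans (le_max_left _ _) hn
  have hn2 : 4 * (p + 2 * q + 2 ^ q + 1) ≤ M.E.ncard := le_trans (le_max_right _ _) hn
  have hpos : 1 ≤ M.E.ncard := by
    generalize hk : 2 ^ q = k at hn2 ⊢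
    omega
  have hcap := ncard_eRk_le_le_of_free_two_pow M hfree q
  have hcapq : ({X : Set α | X ⊆ M.E ∧ M.eRk X ≤ (q : ℕ∞)}.ncard : ℚ) ≤
      ∑ j ∈ Finset.range (q + 1), (M.E.ncard.choose j : ℚ) * 2 ^ (2 ^ j - 1 - j) := by
    exact_mod_cast hcap
  refine rls_of_hyperplane_key M p q hR hfree _ hcapq ?_
  have hΦ := phiK_le_two_pow p q
  have hΦ0 := phiK_nonneg p q
  have hsum := sum_choose_two_pow_le M.E.ncard q hpos
  have hpow : (M.E.ncard : ℚ) ^ q ≤ (2 : ℚ) ^ (M.E.ncard / 4) := by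
    exact_mod_cast pow_le_two_pow_div_four q M.E.ncard hn1
  have hq1 : (q + 1 : ℚ) ≤ (2 : ℚ) ^ q := by
    exact_mod_cast Nat.succ_le_of_lt (Nat.lt_two_pow_self (n := q))
  have hΦ1 : phiK p q + 1 ≤ (2 : ℚ) ^ (p + q + 1) := by
    have : (1 : ℚ) ≤ 2 ^ (p + q) := one_le_pow₀ (by norm_num)
    calc phiK p q + 1 ≤ 2 ^ (p + q) + 2 ^ (p + q) := by linarith
      _ = (2 : ℚ) ^ (p + q + 1) := by ring
  have hexp : p + q + 1 + q + 2 ^ q + M.E.ncard / 4 ≤ M.E.ncard / 2 := by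
    generalize hk : 2 ^ q = k at hn2 ⊢
    omega
  have hS0 : (0 : ℚ) ≤ ∑ j ∈ Finset.range (q + 1), (M.E.ncard.choose j : ℚ) * 2 ^ (2 ^ j - 1 - j) :=
    Finset.sum_nonneg (fun _ _ => by positivity)
  calc (phiK p q + 1) * ∑ j ∈ Finset.range (q + 1), (M.E.ncard.choose j : ℚ) * 2 ^ (2 ^ j - 1 - j)
      ≤ (2 : ℚ) ^ (p + q + 1) * ((q + 1 : ℚ) * (M.E.ncard : ℚ) ^ q * 2 ^ (2 ^ q)) :=
        mul_le_mul hΦ1 hsum hS0 (by positivity)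
    _ ≤ (2 : ℚ) ^ (p + q + 1) * ((2 : ℚ) ^ q * (2 : ℚ) ^ (M.E.ncard / 4) * 2 ^ (2 ^ q)) := by
        apply mul_le_mul_of_nonneg_left _ (by positivity)
        apply mul_le_mul_of_nonneg_right _ (by positivity)
        exact mul_le_mul hq1 hpow (by positivity) (by positivity)
    _ = (2 : ℚ) ^ (p + q + 1 + q + 2 ^ q + M.E.ncard / 4) := by
        simp only [pow_add]
        ring
    _ ≤ (2 : ℚ) ^ (M.E.ncard / 2) := pow_le_pow_right₀ (by norm_num) hexp

end HypKey

end PercRepro
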